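import Summits.MatrixMultiplication.MatrixMultiplication.Theorems.EdgePencilFlatSummandGaugeLaws
import HarnessLib

/-!
# The list price is attained in `T₄(F)`: `[W_n^{(e)}] ≤ e·[D_n]`, hence
# `[W_n^{(e)}] ≲ c·[D_n] ↔ e ≤ c` — the host's exchange rate is exactly linear

Support kernel for `stmt-MatrixMultiplication-26697` (`TetraExcessZero`, route `TetrahedronCarving`; cut of
record `closes (TetraExcessZero) (TetraPlusTwo) : ω = 2`, UNCHANGED; lineage `decomp-mm-lens-6`, generation 43).
No item is added or changed; no definition is introduced. Notation as in `EdgePencilFlatSummandGauge(Laws)`: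
`W_n^{(e)} = sixTetra F n e`, `D_n = W_n^{(1)}`, `T₄(F) = DTensorClass F 4`, `[t] = DTensorClass.mk t`,
`≲ = AsympLe (· ≤ ·)`.

`EdgePencilFlatSummandGaugeLaws.le_of_asympLe_mul_diamond` priced the host alone from BELOW (`[W_n^{(e)}] ≲
c·[D_n] ⟹ e ≤ c`, by the gauge point `ζ^{(02)}`); the matching upper bound was so far only a RANK
inequality (`EdgePencilSixth.tensorRankD_sixTetra_le_mul_diamond : R₄(W_n^{(e)}) ≤ e·R₄(D_n)`). This file
places the diamond cover in the semiring itself: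

* `restricts_unit_kron_diamond_sixTetra` — **`⟨e⟩ ⊠ D_n ≥ W_n^{(e)}` as a RESTRICTION** (explicit maps:
  parties `0,1` read the block index `a = ℓ₀₁` off their own label and re-encode the label with `ℓ₀₁ := 0`;
  parties `2,3`, which do not see `ℓ₀₁`, FOLD the block index — the sum over the `e` blocks of the diamond,
  each placed at `ℓ₀₁ = a` for parties `0,1`, is the thinned tetrahedron);
* `mk_sixTetra_le_natCast_mul_diamond` — `[W_n^{(e)}] ≤ (e : T₄(F))·[D_n]` (`1 ≤ n`; any `e`);
* `asympLe_natCast_mul_diamond_iff` — **`[W_n^{(e)}] ≲ c·[D_n] ↔ e ≤ c`** (`e ≤ n`): on host-only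
  purchases the asymptotic preorder is DECIDED BY ONE GAUGE POINT (`ζ^{(02)}`), and there is no asymptotic
  discount — `k`-th powers, subexponential slack and all of `X(T₄(F))` buy nothing below `e` diamonds;
* `asympLe_natCast_mul_diamond_add_iff_of_lt` — with a flat summand too small to matter
  (`m < n³`): `[W_n^{(e)}] ≲ c·[D_n] + m ↔ e ≤ c`; so in ANY purchase `[W_n^{(e)}] ≲ c·[D_n] + m` with
  `c < e` the summand has `n³ ≤ m` (`cube_le_summand_of_discount`) — the summand's exponent starts at `3`.

Reading for the cell (memo NODE-g43): the search space of the flat-summand purchase has an exactly linear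
host axis; every discount is paid by the summand, at `ζ^{(02)}`-rate `n³` per diamond saved
(`summand_floor_of_purchase`) — the level-mixing mechanism the purchase asks for must manufacture
`ζ^{(02)}`-charge `(e − c)·n³` out of `⟨m⟩`, which no restriction from `⟨m⟩` alone does below `m ≥ e·n³`
… unless the diamond participates (that is the open mechanism; nothing here decides it).

References: Christandl–Vrana–Zuiddam 2023, §1.1–§1.2 (restriction, unit tensor, Kronecker product)
[ChristandlVranaZuiddam2023]; Zuiddam 2018, Def. 2.1, §2.3 [Zuiddam2018]; Strassen 1988 [Strassen1988];
Christandl–Vrana–Zuiddam, arXiv:1609.07476, Ex. 1.1.2 [ChristandlVranaZuiddam2016].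
No `sorry`, no new axiom, no instance, no notation, no definition.
-/

noncomputable section

set_option linter.dupNamespace false

open Finset Literature.Computability.AlgebraicComplexity
open Summit.MatrixMultiplication.MatrixMultiplication.Theorems.TetrahedronTensor
open Summit.MatrixMultiplication.MatrixMultiplication.Theorems.TetraDiagonal
open Summit.MatrixMultiplication.MatrixMultiplication.Theses.TetrahedronCarving

namespace Summit.MatrixMultiplication.MatrixMultiplication.Theorems.EdgePencil

variable {F : Type*} [Field F]

/-! ## §7 The diamond cover as a restriction: `⟨e⟩ ⊠ D_n ≥ W_n^{(e)}` -/

section ListPrice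

/-- Splitting a sum over pair-valued multi-indices into the two component multi-indices.
[folklore] -/
theorem sum_arrow_prod_eq {α β M : Type*} [Fintype α] [Fintype β] [AddCommMonoid M]
    (G : (Fin 4 → α × β) → M) :
    (∑ k : Fin 4 → α × β, G k) = ∑ a : Fin 4 → α, ∑ y : Fin 4 → β, G (fun j => (a j, y j)) := by
  rw [← (Equiv.arrowProdEquivProdArrow (Fin 4) (fun _ => α) (fun _ => β)).symm.sum_comp,
    Fintype.sum_prod_type]
  rfl

/-- **`⟨e⟩ ⊠ D_n ≥ W_n^{(e)}`**: the thinned tetrahedron is a restriction of the Kronecker product of the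
unit `4`-tensor `⟨e⟩` with the diamond. Parties `0` and `1` map their label `x` (which carries `ℓ₀₁` in
slot `0`) to the block `a = ℓ₀₁` and the re-encoded label `(0, ℓ₀₂, ℓ₀₃)` resp. `(0, ℓ₁₂, ℓ₁₃)`; parties
`2` and `3` keep their label and fold the block index. [cite: ChristandlVranaZuiddam2023, §1.1] -/
theorem restricts_unit_kron_diamond_sixTetra {n : ℕ} (hn : 1 ≤ n) (e : ℕ) :
    DTensor.Restricts (DTensor.kron (DTensor.unit F 4 (Fin e)) (sixTetra F n 1)) (sixTetra F n e) := by
  classical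
  haveI : NeZero n := NeZero.of_pos hn
  -- target label per party, and the block test per party
  set ρ : Fin 4 → Fin (n ^ 3) → Fin (n ^ 3) :=
    fun v x => if v = 0 ∨ v = 1 then enc 0 (lab x 1) (lab x 2) else x with hρ
  set χ : Fin 4 → Fin (n ^ 3) → Fin e → F :=
    fun v x b => if v = 0 ∨ v = 1 then (if (b : ℕ) = (lab x 0 : ℕ) then 1 else 0) else 1 with hχ
  refine ⟨fun v x k => χ v x k.1 * (if k.2 = ρ v x then (1 : F) else 0), ?_⟩
  funext x
  rw [DTensor.apply_apply_eq, sum_arrow_prod_eq]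
  simp only [DTensor.kron_apply]
  -- the `y`-sum collapses onto `y₀ v = ρ v (x v)`
  set y₀ : Fin 4 → Fin (n ^ 3) := fun v => ρ v (x v) with hy₀
  have inner : ∀ a : Fin 4 → Fin e,
      (∑ y : Fin 4 → Fin (n ^ 3), (∏ v, χ v (x v) (a v) * (if y v = ρ v (x v) then (1 : F) else 0)) *
        (DTensor.unit F 4 (Fin e) a * sixTetra F n 1 y)) =
      (∏ v, χ v (x v) (a v)) * DTensor.unit F 4 (Fin e) a * sixTetra F n 1 y₀ := by
    intro a
    have hterm : ∀ y : Fin 4 → Fin (n ^ 3),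
        (∏ v, χ v (x v) (a v) * (if y v = ρ v (x v) then (1 : F) else 0)) *
          (DTensor.unit F 4 (Fin e) a * sixTetra F n 1 y) =
        (∏ v, χ v (x v) (a v)) * DTensor.unit F 4 (Fin e) a *
          ((∏ v, (if y v = y₀ v then (1 : F) else 0)) * sixTetra F n 1 y) := by
      intro y
      rw [Finset.prod_mul_distrib]
      ring
    simp_rw [hterm, DTensor.prod_ite_eq_eq, ← Finset.mul_sum, Finset.sum_ite_eq', Finset.mem_univ,
      if_true]
  simp_rw [inner]
  rw [← Finset.sum_mul]
  -- the block factor: only parties `0,1` test the block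
  have hblock : ∀ a : Fin 4 → Fin e, (∏ v, χ v (x v) (a v)) =
      (if ((a 0 : Fin e) : ℕ) = (lab (x 0) 0 : ℕ) then (1 : F) else 0) *
        (if ((a 1 : Fin e) : ℕ) = (lab (x 1) 0 : ℕ) then (1 : F) else 0) := by
    intro a
    rw [Fin.prod_univ_four]
    simp [hχ]
  simp_rw [hblock]
  -- the `a`-sum is the indicator of `ℓ₀₁ < e ∧ ℓ₀₁(x 0) = ℓ₀₁(x 1)`
  have hsum : (∑ a : Fin 4 → Fin e,
      (if ((a 0 : Fin e) : ℕ) = (lab (x 0) 0 : ℕ) then (1 : F) else 0) *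
        (if ((a 1 : Fin e) : ℕ) = (lab (x 1) 0 : ℕ) then (1 : F) else 0) * DTensor.unit F 4 (Fin e) a) =
      ind (((lab (x 0) 0 : ℕ) < e) ∧ lab (x 0) 0 = lab (x 1) 0) := by
    by_cases h : ((lab (x 0) 0 : ℕ) < e) ∧ lab (x 0) 0 = lab (x 1) 0
    · rw [ind, if_pos h]
      obtain ⟨hlt, h01⟩ := h
      set b : Fin e := ⟨(lab (x 0) 0 : ℕ), hlt⟩ with hb
      rw [Finset.sum_eq_single_of_mem (fun _ : Fin 4 => b) (Finset.mem_univ _)]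
      · simp [DTensor.unit_apply, hb, h01]
      · intro a _ hne
        by_cases hu : ∀ j j' : Fin 4, a j = a j'
        · by_cases h0 : ((a 0 : Fin e) : ℕ) = (lab (x 0) 0 : ℕ)
          · exfalso
            apply hne
            funext j
            rw [hu j 0]
            exact Fin.ext h0
          · rw [if_neg h0, zero_mul, zero_mul]
        · rw [DTensor.unit_apply, if_neg hu, mul_zero]
    · rw [ind, if_neg h]
      refine Finset.sum_eq_zero fun a _ => ?_
      by_cases h0 : ((a 0 : Fin e) : ℕ) = (lab (x 0) 0 : ℕ)
      · by_cases h1 : ((a 1 : Fin e) : ℕ) = (lab (x 1) 0 : ℕ)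
        · by_cases hu : ∀ j j' : Fin 4, a j = a j'
          · exfalso
            apply h
            refine ⟨?_, ?_⟩
            · rw [← h0]; exact (a 0).isLt
            · apply Fin.ext
              rw [← h0, ← h1, hu 0 1]
          · rw [DTensor.unit_apply, if_neg hu, mul_zero]
        · rw [if_neg h1, mul_zero, zero_mul]
      · rw [if_neg h0, zero_mul, zero_mul]
  rw [hsum]
  -- evaluate the diamond at `y₀` and compare with `W_n^{(e)}` at `x`
  have h0 : y₀ 0 = enc 0 (lab (x 0) 1) (lab (x 0) 2) := by simp [hy₀, hρ]
  have h1 : y₀ 1 = enc 0 (lab (x 1) 1) (lab (x 1) 2) := by simp [hy₀, hρ]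
  have h2 : y₀ 2 = x 2 := by simp [hy₀, hρ]
  have h3 : y₀ 3 = x 3 := by simp [hy₀, hρ]
  rw [sixTetra_apply, sixTetra_apply, h0, h1, h2, h3, ind_mul_ind]
  simp only [lab_enc_fst, lab_enc_snd, lab_enc_thd, Fin.val_zero, Nat.lt_one_iff, true_and]
  exact ind_congr (by tauto)

/-- **The list price is attained in `T₄(F)`**: `[W_n^{(e)}] ≤ e·[D_n]` (`1 ≤ n`, any `e`).
[cite: ChristandlVranaZuiddam2023, §1.2] -/
theorem mk_sixTetra_le_natCast_mul_diamond {n : ℕ} (hn : 1 ≤ n) (e : ℕ) :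
    DTensorClass.mk (sixTetra F n e) ≤ (e : DTensorClass F 4) * DTensorClass.mk (sixTetra F n 1) := by
  rw [DTensorClass.natCast_eq_mk, DTensorClass.mk_mul_mk, DTensorClass.mk_le_mk_iff]
  exact restricts_unit_kron_diamond_sixTetra hn e

/-- Monotonicity of the host multiplicity: `e ≤ c ⟹ e·[D] ≤ c·[D]` in `T₄(F)`.
[cite: ChristandlVranaZuiddam2023, §1.2] -/
theorem natCast_mul_le_natCast_mul_of_le {e c : ℕ} (h : e ≤ c) (x : DTensorClass F 4) :
    (e : DTensorClass F 4) * x ≤ (c : DTensorClass F 4) * x := by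
  obtain ⟨d, rfl⟩ := Nat.exists_eq_add_of_le h
  rw [Nat.cast_add, add_mul]
  simpa using DTensorClass.add_le_add (le_refl ((e : DTensorClass F 4) * x))
    (DTensorClass.zero_le ((d : DTensorClass F 4) * x))

/-- **`[W_n^{(e)}] ≤ c·[D_n]` for every `c ≥ e`** (genuine restriction, no asymptotics).
[cite: ChristandlVranaZuiddam2023, §1.2] -/
theorem mk_sixTetra_le_natCast_mul_diamond_of_le {n e c : ℕ} (hn : 1 ≤ n) (h : e ≤ c) :
    DTensorClass.mk (sixTetra F n e) ≤ (c : DTensorClass F 4) * DTensorClass.mk (sixTetra F n 1) :=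
  (mk_sixTetra_le_natCast_mul_diamond hn e).trans (natCast_mul_le_natCast_mul_of_le h _)

/-- **THE HOST'S EXCHANGE RATE IS EXACTLY LINEAR**: for `e ≤ n`,
`[W_n^{(e)}] ≲ c·[D_n] ↔ e ≤ c` — decided by the single gauge point `ζ^{(02)}` (necessity,
`le_of_asympLe_mul_diamond`) and the diamond cover (sufficiency, already a restriction).
[cite: Strassen1988, Thm. (spectral characterisation)] -/
theorem asympLe_natCast_mul_diamond_iff {n e c : ℕ} (hn : 1 ≤ n) (he : e ≤ n) :
    AsympLe (fun x y : DTensorClass F 4 => x ≤ y) (DTensorClass.mk (sixTetra F n e))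
      ((c : DTensorClass F 4) * DTensorClass.mk (sixTetra F n 1)) ↔ e ≤ c := by
  have hSP : IsStrassenPreorder (fun x y : DTensorClass F 4 => x ≤ y) :=
    DTensorClass.isStrassenPreorder F 2
  exact ⟨le_of_asympLe_mul_diamond hn he,
    fun h => hSP.asympLe_of_le (mk_sixTetra_le_natCast_mul_diamond_of_le hn h)⟩

end ListPrice

/-! ## §8 A summand below `n³` buys nothing: the summand's exponent starts at `3` -/

section SmallSummand

/-- **With a flat summand `m < n³` the purchase is again decided by the list price**:
`[W_n^{(e)}] ≲ c·[D_n] + m ↔ e ≤ c` (`e ≤ n`). Necessity: `ζ^{(02)}` gives `e·n³ ≤ c·n³ + m < (c+1)·n³`;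
sufficiency: the diamond cover and `x ≤ x + m`. [cite: Strassen1988, Thm. (spectral characterisation)] -/
theorem asympLe_natCast_mul_diamond_add_iff_of_lt {n e c m : ℕ} (hn : 1 ≤ n) (he : e ≤ n)
    (hm : m < n ^ 3) :
    AsympLe (fun x y : DTensorClass F 4 => x ≤ y) (DTensorClass.mk (sixTetra F n e))
      ((c : DTensorClass F 4) * DTensorClass.mk (sixTetra F n 1) + (m : DTensorClass F 4)) ↔ e ≤ c := by
  constructor
  · intro h
    have hf := summand_floor_of_purchase hn he h
    have : e * n ^ 3 < (c + 1) * n ^ 3 := by nlinarith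
    have := Nat.lt_of_mul_lt_mul_right this
    omega
  · intro h
    have hSP : IsStrassenPreorder (fun x y : DTensorClass F 4 => x ≤ y) :=
      DTensorClass.isStrassenPreorder F 2
    refine hSP.asympLe_of_le ?_
    have h₁ := mk_sixTetra_le_natCast_mul_diamond_of_le (F := F) hn h
    simpa using DTensorClass.add_le_add h₁ (DTensorClass.zero_le (m : DTensorClass F 4))

/-- **Every discounted purchase carries a summand of exponent at least `3`**: `[W_n^{(e)}] ≲ c·[D_n] + m`
with `c < e ≤ n` forces `n³ ≤ m`. [cite: ChristandlVranaZuiddam2023, Example 1.4] -/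
theorem cube_le_summand_of_discount {n e c m : ℕ} (hn : 1 ≤ n) (he : e ≤ n) (hc : c < e)
    (h : AsympLe (fun x y : DTensorClass F 4 => x ≤ y) (DTensorClass.mk (sixTetra F n e))
      ((c : DTensorClass F 4) * DTensorClass.mk (sixTetra F n 1) + (m : DTensorClass F 4))) :
    n ^ 3 ≤ m := by
  by_contra hm
  rw [not_le] at hm
  have := (asympLe_natCast_mul_diamond_add_iff_of_lt hn he hm).1 h
  omega

end SmallSummand

end Summit.MatrixMultiplication.MatrixMultiplication.Theorems.EdgePencil

end
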